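import Summits.QuantumAdvantage.QuantumAdvantage.Theorems.LinnikCubicClassGroupsDegreeOnePrimesEscapeConjClassShortInterval
import HarnessLib

/-!
# Real-variable preliminaries for the Deuring–Heilbronn-sharp short-interval Chebotarev theorem

Topic `Summits/QuantumAdvantage/QuantumAdvantage/Theorems`, cell B2b-1 (linnik-cubic), PART A (gen 17); helper
toward the crux `DegreeOnePrimesEscape` (stmt-QuantumAdvantage-11543) of route `LinnikCubicClassGroups`
(value = lemmas for a theorem, NOT summit progress).

* `half_min_le_one_sub_exp_neg` — `min(1,u)/2 ≤ 1 − e^{−u}` (`u ≥ 0`);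
* `half_min_mul_le_flat` — the flat main term is positive and comparable to `h`:
  `(h/2) min(1,(1−β) log x) ≤ h − ((x+h)^β − x^β)/β` (`x ≥ 1`, `h ≥ 0`, `0 < β < 1`);
* `junk_le_quarter_mul_rel` — the prime-power/ramified junk `120 n x^{3/4}` is `≤ (κ/4)(c₁ Q^{−2}) h` once
  `x ≥ d^L`, `Q^{32} ≤ x`, `L ≥ (64/11) log(480 n/(κ c₁))`, `h ≥ x^{1−δ}`, `δ ≤ 1/64`.
-/

noncomputable section

open Real

namespace Summit.QuantumAdvantage.QuantumAdvantage.Theorems.DegreeOnePrimesEscape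

/-! ### Real-variable preliminaries -/

/-- `min(1,u)/2 ≤ 1 − e^{−u}` for `u ≥ 0`. -/
theorem half_min_le_one_sub_exp_neg {u : ℝ} (hu : 0 ≤ u) : min 1 u / 2 ≤ 1 - Real.exp (-u) := by
  have hE := Real.exp_pos (-u)
  rcases le_or_gt u 1 with h | h
  · rw [min_eq_right h]
    -- `e^{-u} (1 + u) ≤ 1` and `1/(1+u) ≤ 1 − u/2` on `[0,1]`
    have h1 : Real.exp (-u) * (1 + u) ≤ 1 := by
      have h2 : u + 1 ≤ Real.exp u := Real.add_one_le_exp u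
      have h3 : Real.exp (-u) * Real.exp u = 1 := by rw [← Real.exp_add]; simp
      nlinarith
    nlinarith [mul_nonneg hu (sub_nonneg.2 h)]
  · rw [min_eq_left h.le]
    have h1 : Real.exp (-u) ≤ Real.exp (-1) := Real.exp_le_exp.2 (by linarith)
    have h3 : Real.exp (-1) * Real.exp 1 = 1 := by rw [← Real.exp_add]; simp
    nlinarith [Real.exp_one_gt_d9, Real.exp_pos (-1)]

/-- **The flat main term dominates `h·min(1,(1−β)log x)/2`**: for `1 ≤ x`, `0 ≤ h`, `0 < β < 1`,
`(h/2)·min(1, (1−β) log x) ≤ h − ((x+h)^β − x^β)/β`. -/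
theorem half_min_mul_le_flat {x h β : ℝ} (hx : 1 ≤ x) (hh : 0 ≤ h) (hβ0 : 0 < β) (hβ1 : β < 1) :
    h / 2 * min 1 ((1 - β) * Real.log x) ≤ h - ((x + h) ^ β - x ^ β) / β := by
  have hx0 : 0 < x := by linarith
  have hI := rpow_window_div_le hx0 hh hβ0 hβ1.le
  have hexp : x ^ (β - 1) = Real.exp (-((1 - β) * Real.log x)) := by
    rw [Real.rpow_def_of_pos hx0]; congr 1; ring
  have hmin := half_min_le_one_sub_exp_neg (u := (1 - β) * Real.log x)
    (mul_nonneg (by linarith) (Real.log_nonneg hx))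
  rw [← hexp] at hmin
  have := mul_le_mul_of_nonneg_left hmin hh
  nlinarith [mul_nonneg hh (Real.rpow_nonneg hx0.le (β - 1))]

/-- **The junk threshold, relative form**: for `x ≥ d^L` (`d ≥ 3`), `Q^{32} ≤ x`, `L ≥ (64/11) log(480 n/(κc₁))`,
`L ≥ 0`, `δ ≤ 1/64`, `x^{1−δ} ≤ h`: `120 n x^{3/4} ≤ (κ/4)(c₁ Q^{−2}) h`. -/
theorem junk_le_quarter_mul_rel {n κ c₁ d L δ x h Q : ℝ} (hn : 0 < n) (hκ : 0 < κ) (hc₁ : 0 < c₁) (hd : 3 ≤ d)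
    (hL : 64 / 11 * Real.log (480 * n / (κ * c₁)) ≤ L) (hL0 : 0 ≤ L) (hx : d ^ L ≤ x) (hQ0 : 0 < Q)
    (hQx : Q ^ (32 : ℝ) ≤ x) (hδ : δ ≤ 1 / 64) (hhx : x ^ (1 - δ) ≤ h) :
    120 * n * x ^ (3 / 4 : ℝ) ≤ κ / 4 * (c₁ * Q ^ (-(2 : ℝ))) * h := by
  have hd0 : 0 < d := by linarith
  have hd1 : 1 < d := by linarith
  have hx1 : 1 ≤ x := le_trans (Real.one_le_rpow hd1.le hL0) hx
  have hx0 : 0 < x := by linarith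
  have hlog3 : 1 ≤ Real.log 3 := by
    rw [Real.le_log_iff_exp_le (by norm_num)]
    have := Real.exp_one_lt_d9; linarith
  have hlogx : L ≤ Real.log x := by
    have h1 := Real.log_le_log (Real.rpow_pos_of_pos hd0 L) hx
    rw [Real.log_rpow hd0] at h1
    have h2 : Real.log 3 ≤ Real.log d := Real.log_le_log (by norm_num) hd
    nlinarith
  -- `x^{11/64} ≥ 480 n/(κc₁)`
  have hpow : 480 * n / (κ * c₁) ≤ x ^ (11 / 64 : ℝ) := by
    have h1 : Real.log (480 * n / (κ * c₁)) ≤ 11 / 64 * Real.log x := by nlinarith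
    calc 480 * n / (κ * c₁) = Real.exp (Real.log (480 * n / (κ * c₁))) := (Real.exp_log (by positivity)).symm
      _ ≤ Real.exp (11 / 64 * Real.log x) := Real.exp_le_exp.2 h1
      _ = x ^ (11 / 64 : ℝ) := by rw [Real.rpow_def_of_pos hx0, mul_comm]
  -- `Q² ≤ x^{1/16}`
  have hQ2 : Q ^ (2 : ℝ) ≤ x ^ (1 / 16 : ℝ) := by
    have := Real.rpow_le_rpow (by positivity) hQx (by norm_num : (0:ℝ) ≤ 1 / 16)
    rwa [← Real.rpow_mul hQ0.le, show (32 : ℝ) * (1 / 16) = 2 by norm_num] at this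
  have hQm2 : Q ^ (-(2 : ℝ)) = (Q ^ (2 : ℝ))⁻¹ := Real.rpow_neg hQ0.le 2
  have hQ2pos : 0 < Q ^ (2 : ℝ) := Real.rpow_pos_of_pos hQ0 _
  -- `x^{3/4} x^{11/64} x^{1/16} ≤ x^{1−δ}`
  have hsplit : x ^ (3 / 4 : ℝ) * x ^ (11 / 64 : ℝ) * x ^ (1 / 16 : ℝ) ≤ x ^ (1 - δ) := by
    rw [← Real.rpow_add hx0, ← Real.rpow_add hx0]
    exact Real.rpow_le_rpow_of_exponent_le hx1 (by linarith)
  have hx34 : 0 ≤ x ^ (3 / 4 : ℝ) := Real.rpow_nonneg hx0.le _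
  have hx11 : 0 ≤ x ^ (11 / 64 : ℝ) := Real.rpow_nonneg hx0.le _
  -- `120 n x^{3/4} Q² ≤ 120 n x^{3/4} x^{1/16}` and `(480n/(κc₁)) ≤ x^{11/64}`
  have h1 : 120 * n * x ^ (3 / 4 : ℝ) * (480 * n / (κ * c₁)) * Q ^ (2 : ℝ) ≤ 120 * n * x ^ (1 - δ) := by
    calc 120 * n * x ^ (3 / 4 : ℝ) * (480 * n / (κ * c₁)) * Q ^ (2 : ℝ)
        ≤ 120 * n * x ^ (3 / 4 : ℝ) * x ^ (11 / 64 : ℝ) * x ^ (1 / 16 : ℝ) := by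
          refine mul_le_mul (mul_le_mul_of_nonneg_left hpow (by positivity)) hQ2 hQ2pos.le (by positivity)
      _ = 120 * n * (x ^ (3 / 4 : ℝ) * x ^ (11 / 64 : ℝ) * x ^ (1 / 16 : ℝ)) := by ring
      _ ≤ 120 * n * x ^ (1 - δ) := mul_le_mul_of_nonneg_left hsplit (by positivity)
  have h2 : 120 * n * x ^ (1 - δ) ≤ 120 * n * h := mul_le_mul_of_nonneg_left hhx (by positivity)
  have hq : 0 < 480 * n / (κ * c₁) * Q ^ (2 : ℝ) := by positivity
  have h4 : 120 * n * x ^ (3 / 4 : ℝ) ≤ 120 * n * h / (480 * n / (κ * c₁) * Q ^ (2 : ℝ)) := by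
    rw [le_div_iff₀ hq]
    calc 120 * n * x ^ (3 / 4 : ℝ) * (480 * n / (κ * c₁) * Q ^ (2 : ℝ))
        = 120 * n * x ^ (3 / 4 : ℝ) * (480 * n / (κ * c₁)) * Q ^ (2 : ℝ) := by ring
      _ ≤ 120 * n * h := h1.trans h2
  have h5 : 120 * n * h / (480 * n / (κ * c₁) * Q ^ (2 : ℝ)) = κ / 4 * (c₁ * Q ^ (-(2 : ℝ))) * h := by
    rw [hQm2]; field_simp; ring
  linarith [h4, h5.le, h5.ge]

end Summit.QuantumAdvantage.QuantumAdvantage.Theorems.DegreeOnePrimesEscape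

end
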